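import Summits.QuantumFields.YangMills.Theorems.BalabanUVNodesK0V23Defs
import Summits.QuantumFields.YangMills.Theorems.BalabanUVNodesK0TopIndexWrapGeometry
import Literature.MathematicalPhysics.QuantumFieldTheory.Balaban1983to89.Node00.LargeFieldBackgroundOfRecord
import Literature.MathematicalPhysics.QuantumFieldTheory.Balaban1983to89.B15Claim189LambdaPin
import Summits.QuantumFields.YangMills.Theorems.BalabanUVNodesK0Stub1BHolds
import Summits.QuantumFields.YangMills.Theorems.BalabanUVNodesN07Thm1ScaledInterfaceInstance
import Literature.MathematicalPhysics.QuantumFieldTheory.Balaban1983to89.Node00.Record12BgRowCoDivBridge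

/-!
# K0⁷ ∕ N07 — THE (T1) SOCKET AT THE TOP INDEX: the V23 text's [15] (8)-antecedent `VariationalThm1RegSepCoP7MGB … (lamDatum F) (dataSmall7LamTopOf F N) B₃ a₀ a₁`, read at the
# «no large field» (2.18) index `Ω_j = T_η`, IS Theorem 1's (8)→(9) REGULARITY TRANSFER for the ONE-SCALE problem (0.21) in node00-def-B's `IsBackground` currency — class (6) at the top
# = `bgReg_k(ε₀) ∩ {(1.9) at scale k}`, fibre = `{Ū^k U = V}`, datum (7) = `|∂V − 1| < δ` — within the text's level guard `k + c₀, k + c₁ ≤ m + K`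

Cell `pub-ymgap`, width seat `pub-ymgap-dag-n07-w3` (g20; N07 [B11] ∕ K0⁷ junction).  `--kind proof --supports stmt-QuantumFields-20541 --as helper`, COUNT-NEUTRAL.  NEW leaf;
theorems only — 0 `def`, 0 `sorry`, 0 `instance`, 0 `notation`.  Imports `…K0V23Defs` (the V23 texts' vocabulary; cone-free), dag-n21-c g10's `…K0TopIndexWrapGeometry` (`exists_seq_top`:
the separated top index) and node00's `LargeFieldBackgroundOfRecord` (`genSet_eq_atScale_of_top`).  [15] = [Balaban1985Variational]; [III] = [Balaban1988Convergent]; [6] =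
[Balaban1985RegularSpaces]; [I] = [Balaban1987RG1].

WHY (CRIT-1 g32's sheet `Cruxes/Record13SepCoPHInhabited/CRIT-1-R2-seat3-radius-collapse-g32.md`: «the antecedent `VariationalThm1RegSepTop7MGB` concludes `∀ U₀, IsMinimizerB (avOfRecord F N K)
{U | PlaqSmallOn … ∧ CoDivClassOnTop …} (bd K k s.Ω) W U₀ → (B₃δ-smallness of U₀)`, while β reads `Uk := dite (UkExists …) Classical.choose 1` over `IsBackground (avOfRecord F N K) (bgReg F N K k ε)
k V` — two predicates, two classes, NO BRIDGE LEMMA … (T1) … the one new SOCKET the K0 road never built»).  THIS FILE builds the (8)-half of that socket.  At dag-n21-c's separated TOP index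
`s` (`Ω_j = T_η`, `1 ≤ j ≤ k`; [III] (2.18)'s leading term) every multi-scale object of the text collapses to its scale-`k` member: the determining bonds `lamBondsSeq s.Ω k` are ALL level-`k` bonds
and NO lower bond (`genSet = atScale k`, §2), so print's fibre `AgreeOnB (lamDatum …) (Ū U) W` is `Ū^k U = W_k`; the support `suppDomOfRecord` is `T_η` (§2, `subset_hullD`); class (6) on the top
domain is `{|∂U − 1| < ε₀η_n² ∀ n ≤ k} ∩ {(1.9) at ε₀η_n³ ∀ n ≤ k}` = `bgReg_k(ε₀) ∩ {(1.9) at scale k}` (the scale-`k` member is the strongest, §3); print's (7) datum `dataSmall7LamTopOf` is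
`|∂W_k − 1| < δ_k` (lower `Λ`-ranges are empty, the top mixed field is `W_k` itself, §4); and the guard `A‴(c, c₀, c₁)` is met by `ν.M₁ := max c 1`, `ν.r := 0` (`R_j = 1`), `M := L^{c₁}`
(`L^{i+c₁} ∣ 2L^{m+K}`) exactly when `k + c₁ ≤ m + K` (§5).  Hence ★★★ §6 `plaqSmall_of_isBackground_classTop_of_thm1RegSepCoP7MGB`: the text's (8)-sentence ⟹ for every `(K, k)` inside
the level guard, every `0 < δ ≤ a₁`, `B₃δ ≤ ε₀ ≤ a₀`, every `δ`-regular datum `V` and every minimiser `U₀` of the Wilson action over `bgReg_k(ε₀) ∩ {(1.9)_k at ε₀}` with `Ū^k U₀ = V`: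
`|U₀(∂p) − 1| < B₃δη_k²` everywhere AND the (1.9) bound `B₃δη_k³` — i.e. n07-a's Theorem-1-at-objects regularity clause (dag-n21-c's `plaqSmall_minimiser_of_thm1_objects` conclusion, there
obtained from (8)+(6)) WITHOUT the uniqueness clause, from the K0 road's OWN antecedent.  §7 ★★★ `exists_plaqSmall_of_isBackground_classTop_SU2`: at `N = 2` the antecedent IS a tree
theorem (stub 1ᴮ ✓p767981 + 53′), so §6 holds with NO hypothesis — inside the witness's (large) level guard.  §8 ★★★ the class IS n01-b's `InUkClassB11 F N K k ε₀` ([15] (2) at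
`Ω_j = T`; node00-def-P11's (1.9) dictionary `coDivSmallOn_bondsOf_iff_regDivAt`), so the socket reads VERBATIM in n07-a∕dag-n21-c currency: `IsBackground … {U | InUkClassB11 F N K k ε₀ U} k V U′
→ PlaqSmall (B₃δη_k²) U′ ∧ InUkClassB11 … (B₃δ) U′` (`plaqSmall_of_isBackground_inUkClassB11_of_thm1RegSepCoP7MGB`, `exists_plaqSmall_of_isBackground_inUkClassB11_SU2`).

WHAT THIS DOES AND DOES NOT GIVE (binding).  The V23 text's (8)-antecedent is a THEOREM at `N = 2` for small radii (dag-n07-e ✓p767981 `K0Stub1BHolds` + k0-s1-w1 53′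
`variationalThm1RegSepCoP7MGB_of_prop8TopStepGB_lamDatum`, packaged in this seat's g16 `…K0V23Stub3NonVacuity.exists_radius_antecedentsZB_inhabited_below`) — BUT with the S1c chain's
level guard `c₀ ≥ m + 48` (125′'s witness), so the unconditional instance of §6 covers only levels `k ≤ K + m − c₀`, far below the top of the tower; NOTHING here discharges N07's slot at
the levels the K0∕N09 doors read.  The class is (6) WITH the scale-`k` (1.9) member (`InUkClassB11`-species), not node00-def-B's bare `bgReg` (D-defB-1); existence and uniqueness
((T1c), (6)) are not touched.  NO β estimate; nothing of Bałaban's asserted; stub 2′ OPEN; K0⁷ stmt-QuantumFields-20541 NOT closed; N07 NOT discharged; COUNT 8∕28 · K 1∕4 UNMOVED;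
R4 = the CONDITIONAL finite-𝕋⁴ rung `BalabanLadder.UV` at fixed `ε = L^(−K)` only — NOT continuum ∕ ℝ⁴ ∕ OS; the Yang–Mills mass gap (Clay) is NOT proved by any of this.  Standard axioms.
-/

noncomputable section

open MeasureTheory Set
open scoped Matrix.Norms.L2Operator

namespace Summit.QuantumFields.YangMills.BalabanUVNodes.K0TopSocketOfThm1RegText

open Literature.MathematicalPhysics.QuantumFieldTheory.Balaban1983to89
open Literature.MathematicalPhysics.QuantumFieldTheory.Balaban1983to89.Node00
open Literature.MathematicalPhysics.QuantumFieldTheory.Balaban1983to89.T4Continuum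
open B15DeterminingSets B15DeterminingSetsB B14.Eq218Concrete
open Summit.QuantumFields.YangMills.Theorems.K0TopIndexWrapGeometry (exists_seq_top)
open Summit.QuantumFields.YangMills.BalabanUVNodes.N07Thm1ScaledInterfaceInstance (RkOfRecord_zero_r)
open Summit.QuantumFields.YangMills.BalabanUVNodes.K0Stub1BHolds (prop8StepCoPGridGBAt_holds)
open Summit.QuantumFields.YangMills.BalabanUVNodes.N07Thm1Top7FromProp8GuardedB (variationalThm1RegSepCoP7MGB_of_prop8TopStepGB_lamDatum)

variable {F : T4Family} {N : ℕ} [NeZero N]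

/-! ## §1  The guard's divisibility letter `L^{i+c₁} ∣ 2L^{m+K}` (`R_j = 1` at `r = 0` is dag-n07-d's `RkOfRecord_zero_r`) -/

omit [NeZero N] in
/-- The guard's divisibility at `M := L^{c₁}`, `R_i := 1`: `L^i·L^{c₁}·1 ∣ 2L^{m+K}` for `i + c₁ ≤ m + K`. [cite: Balaban1988Convergent, (2.1) p.254 (bookkeeping)] -/
theorem dCubeSide_dvd_sitesPerDir (K : ℕ) {i c₁ : ℕ} (h : i + c₁ ≤ F.m + K) :
    dCubeSide (F.P K).L (F.L ^ c₁) 1 i ∣ (F.P K).sitesPerDir 0 := by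
  rw [T4Family.sitesPerDir_eq, dCubeSide, T4Family.P_L, mul_one, ← pow_add]
  exact Dvd.dvd.mul_left (pow_dvd_pow F.L h) 2

/-! ## §2  The top index: determining bonds, `Λ`-plaquettes and the support collapse to scale `k` -/

section Top

variable {P : Params}

omit [NeZero N] in
/-- **At a top index the level-`k` determining bonds of print's (2.3) datum are ALL bonds.** [cite: Balaban1984PropagatorsII, (2.3) p.224; Balaban1988Convergent, (2.2) p.255] -/
theorem lamBondsSeq_top_self {Ω : ℕ → Set (Site P 0)} {k : ℕ} (hk : 1 ≤ k) (hΩ : ∀ j, 1 ≤ j → j ≤ k → Ω j = Set.univ) :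
    lamBondsSeq Ω k k = Set.univ := by
  ext b
  rw [mem_lamBondsSeq_iff, genSet_eq_atScale_of_top Ω hk hΩ]
  simp [atScale, B8Eq17ClassAkV1.bondsOf_univ]

omit [NeZero N] in
/-- **… and there are NO determining bonds below scale `k`.** [cite: Balaban1984PropagatorsII, (2.3) p.224; Balaban1988Convergent, (2.2) p.255] -/
theorem lamBondsSeq_top_of_ne {Ω : ℕ → Set (Site P 0)} {k : ℕ} (hk : 1 ≤ k) (hΩ : ∀ j, 1 ≤ j → j ≤ k → Ω j = Set.univ) {j : ℕ} (hj : j ≠ k) :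
    lamBondsSeq Ω k j = ∅ := by
  ext b
  rw [mem_lamBondsSeq_iff, genSet_eq_atScale_of_top Ω hk hΩ]
  simp [atScale, hj, Node00.bondsOf_empty]

omit [NeZero N] in
/-- **At a top index the `Λ`-plaquettes below scale `k` are void** (`Λ_n = ∅`, `n < k`; at `n = 0`, `Γ₀ = (Ω₁)ᶜ = ∅`). [cite: Balaban1985Variational, (7) p.278; Balaban1988Convergent, (2.2) p.255] -/
theorem lamPlaqs_top_of_ne {Ω : ℕ → Set (Site P 0)} {k : ℕ} (hk : 1 ≤ k) (hΩ : ∀ j, 1 ≤ j → j ≤ k → Ω j = Set.univ) {n : ℕ} (hn : n ≠ k) :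
    Sect2.lamPlaqs Ω k n = ∅ := by
  ext p
  rw [Sect2.mem_lamPlaqs_iff, genSet_eq_atScale_of_top Ω hk hΩ]
  simp [atScale, hn, B8Eq17ClassAkV1.plaqsOf]

/-- **The support of record of a top index is the whole torus** (`Ω₁ = T_η ⊆ hullD … Ω₁`). [cite: Balaban1988Convergent, p.255 (bookkeeping)] -/
theorem suppDomOfRecord_top (ν : Stage7Numerics) (hM₁ : 0 < ν.M₁) (K : ℕ) {Ω : ℕ → Set (Site (F.P K) 0)} {k : ℕ} (hk : 1 ≤ k)
    (hΩ : ∀ j, 1 ≤ j → j ≤ k → Ω j = Set.univ) : suppDomOfRecord F ν K Ω = Set.univ := by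
  rw [suppDomOfRecord_eq, Set.eq_univ_iff_forall]
  intro x
  have h := B15Claim189LambdaPin.subset_hullD (P := F.P K) hM₁ 1 (Ω 1) (show x ∈ Ω 1 by rw [hΩ 1 le_rfl hk]; trivial)
  exact h

end Top

/-! ## §3  Class (6) on the top domain of a top index = `bgReg_k(ε₀) ∩ {(1.9) at scale k}` -/

section ClassTop

omit [NeZero N] in
/-- `η_k ≤ η_n` for `n ≤ k` (`η_j = L^{−j}`, `L ≥ 1`). [cite: Balaban1987RG1, (1.1) p.260 (bookkeeping)] -/
theorem eta_anti (K : ℕ) {n k : ℕ} (h : n ≤ k) : (F.P K).eta k ≤ (F.P K).eta n := by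
  have hL1 : (1 : ℝ) ≤ ((F.P K).L : ℝ) := by exact_mod_cast (F.P K).L_pos
  unfold Params.eta
  exact pow_le_pow_of_le_one (inv_nonneg.2 (by positivity)) (inv_le_one_of_one_le₀ hL1) h

/-- ★ **CLASS (6) AT A TOP INDEX** (top domain `T_η`): `U` satisfies «`|∂U − 1| < ε₀η_n²` on the plaquettes of `Ω_n`, `n ≤ k`» and «(1.9) at `ε₀η_n³` on the bonds of `Ω_n`, `n ≤ k`» iff
`U ∈ bgReg_k(ε₀)` and the scale-`k` (1.9) member holds (the scale-`k` thresholds are the smallest; `0 ≤ ε₀`). [cite: Balaban1985Variational, (2),(6) p.278; Balaban1985RegularSpaces, (1.7)–(1.9) p.77; Balaban1987RG1, (1.2) p.260] -/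
theorem mem_classTop_iff (K : ℕ) {Ω : ℕ → Set (Site (F.P K) 0)} {k : ℕ} (hΩ : ∀ j, 1 ≤ j → j ≤ k → Ω j = Set.univ)
    {ε₀ : ℝ} (hε : 0 ≤ ε₀) (U : GaugeField (F.P K) 0 (SU N)) :
    ((∀ n, n ≤ k → PlaqSmallOn (Sect2.omegaPlaqsTop Ω Set.univ n) (ε₀ * (F.P K).eta n ^ 2) U) ∧ Sect2.CoDivClassOnTop Ω Set.univ k ε₀ U) ↔
      (U ∈ bgReg F N K k ε₀ ∧ Sect2.CoDivSmallOn Set.univ (ε₀ * (F.P K).eta k ^ 3) U) := by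
  have hP : ∀ n, n ≤ k → Sect2.omegaPlaqsTop Ω (Set.univ : Set (Site (F.P K) 0)) n = Set.univ := by
    intro n hn
    rw [Sect2.omegaPlaqsTop_univ, omegaPlaqs]
    by_cases h0 : n = 0
    · rw [if_pos h0]
    · rw [if_neg h0, hΩ n (Nat.one_le_iff_ne_zero.2 h0) hn, B8Eq17ClassAkV1.plaqsOf_univ]
  have hB : ∀ n, n ≤ k → Sect2.omegaBondsTop Ω (Set.univ : Set (Site (F.P K) 0)) n = Set.univ := by
    intro n hn
    rw [Sect2.omegaBondsTop_univ, Sect2.omegaBonds]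
    by_cases h0 : n = 0
    · rw [if_pos h0]
    · rw [if_neg h0, hΩ n (Nat.one_le_iff_ne_zero.2 h0) hn, B8Eq17ClassAkV1.bondsOf_univ]
  have hη0 : ∀ n, 0 ≤ (F.P K).eta n := fun n => by unfold Params.eta; positivity
  constructor
  · rintro ⟨h7, h9⟩
    refine ⟨(mem_bgReg_iff F N K k ε₀ U).2 fun p => h7 k le_rfl p (by rw [hP k le_rfl]; trivial), fun b _ => ?_⟩
    exact h9 k le_rfl b (by rw [hB k le_rfl]; trivial)
  · rintro ⟨h7, h9⟩
    refine ⟨fun n hn p _ => ((mem_bgReg_iff F N K k ε₀ U).1 h7 p).trans_le ?_, fun n hn b _ => (h9 b (Set.mem_univ b)).trans_le ?_⟩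
    · exact mul_le_mul_of_nonneg_left (pow_le_pow_left₀ (hη0 k) (eta_anti K hn) 2) hε
    · exact mul_le_mul_of_nonneg_left (pow_le_pow_left₀ (hη0 k) (eta_anti K hn) 3) hε

end ClassTop

/-! ## §4  Print's (7) datum at a top index is `|∂W_k − 1| < δ_k` -/

section DataTop

/-- ★ **(7) AT A TOP INDEX**: `dataSmall7LamTopOf F N K Ω T_η k δ W` holds as soon as `PlaqSmall (δ k) (W k)` — the `Λ₀`- and `Λ_n`-ranges (`n < k`) are empty, and at scale `k` the (7) field
(datum on the determining bonds, average of `W_{k−1}` elsewhere) IS `W_k` because every level-`k` bond is determining. [cite: Balaban1985Variational, (7) p.278; Balaban1984PropagatorsII, (2.3) p.224] -/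
theorem dataSmall7LamTopOf_top (K : ℕ) {Ω : ℕ → Set (Site (F.P K) 0)} {k : ℕ} (hk : 1 ≤ k) (hΩ : ∀ j, 1 ≤ j → j ≤ k → Ω j = Set.univ)
    {δ : ℕ → ℝ} {W : MSField (F.P K) (SU N)} (hW : PlaqSmall (δ k) (W k)) :
    dataSmall7LamTopOf F N K Ω Set.univ k δ W := by
  refine ⟨?_, ?_⟩
  · -- scale 0: `Λ₀ = ∅` (`k ≥ 1`)
    intro p hp
    have h0 : Sect2.lamPlaqs Ω k 0 = ∅ := lamPlaqs_top_of_ne hk hΩ (by omega)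
    have : p ∈ Sect2.lamPlaqs Ω k 0 := Sect2.lamPlaqsTop_subset Ω Set.univ k hp
    rw [h0] at this
    exact absurd this (Set.notMem_empty p)
  · intro m hm p hp
    rcases hm.eq_or_lt with h | h
    · -- the top scale: the (7) field is `W_k`
      subst h
      have hb : ∀ b : PBond (F.P K) (m + 1), b ∈ lamBondsSeq Ω (m + 1) (m + 1) := fun b => by
        rw [lamBondsSeq_top_self hk hΩ]; trivial
      have hfield : Sect2.mixedFieldB (avOfRecord F N K) (lamBondsSeq Ω (m + 1) (m + 1)) (W (m + 1)) (W m) = W (m + 1) :=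
        funext fun b => spliceAtB_of_mem _ _ (hb b)
      rw [hfield]
      exact hW p
    · -- `Λ_{m+1} = ∅` below the top
      have h0 : Sect2.lamPlaqs Ω k (m + 1) = ∅ := lamPlaqs_top_of_ne hk hΩ (by omega)
      rw [h0] at hp
      exact absurd hp (Set.notMem_empty p)

end DataTop

/-! ## §5–§6  The socket: the text's (8)-sentence ⟹ one-scale (8)→(9) regularity in `IsBackground` currency, inside the level guard -/

section Socket

variable (F N)

/-- ★★★ **THE (T1) SOCKET, (8)-HALF.**  Let the V23 text's [15] antecedent `VariationalThm1RegSepCoP7MGB F N A‴(c, c₀, c₁) (lamDatum F) (dataSmall7LamTopOf F N) B₃ a₀ a₁` hold (`0 ≤ B₃`).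
Then at every member `(K, k)` inside the level guard (`1 ≤ k`, `k + c₀ ≤ m + K`, `k + c₁ ≤ m + K`), for every `0 < δ ≤ a₁` and `B₃δ ≤ ε₀ ≤ a₀`, every `δ`-regular level-`k` datum `V` and
every MINIMISER `U₀` of the Wilson action over the ONE-SCALE class «`bgReg_k(ε₀)` ∩ (1.9) at `ε₀η_k³`» within the fibre `Ū^k U = V` (node00-def-B's `IsBackground` along `avOfRecord`):
`|U₀(∂p) − 1| < B₃δη_k²` for every plaquette and the (1.9) bound `B₃δη_k³` on every bond — [15] Thm 1 (8)→(9)∕(10) for the problem (0.21) of [I], read off the text at dag-n21-c's separated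
top index with `ν.M₁ := max c 1`, `ν.r := 0`, `M := L^{c₁}`, `g := 0`, `δ_n := δ`, `W := Ū U₀`.  CONDITIONAL on the text's antecedent; nothing of Bałaban's asserted.
[cite: Balaban1985Variational, Thm 1 (6)–(10) pp.278–279, (7) p.278; Balaban1988Convergent, (2.1)–(2.2) pp.254–255, (2.12) p.256, (2.18) p.257; Balaban1984PropagatorsII, (2.3) p.224; Balaban1987RG1, (0.21) p.256, (1.2) p.260] -/
theorem plaqSmall_of_isBackground_classTop_of_thm1RegSepCoP7MGB {c c₀ c₁ : ℕ} {B₃ a₀ a₁ : ℝ} (hB₃ : 0 ≤ B₃)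
    (h15 : VariationalThm1RegSepCoP7MGB F N
      (fun ν M g K k _s => c ≤ ν.M₁ ∧ k + c₀ ≤ F.m + K ∧ F.L ^ c₁ ∣ M ∧
        ∀ i, 1 ≤ i → i ≤ k → dCubeSide (F.P K).L M (RkOfRecord (F.P K).L ν.r (g i)) i ∣ (F.P K).sitesPerDir 0) (lamDatum F) (dataSmall7LamTopOf F N) B₃ a₀ a₁)
    {K k : ℕ} (hk : 1 ≤ k) (hc₀ : k + c₀ ≤ F.m + K) (hc₁ : k + c₁ ≤ F.m + K)
    {ε₀ δ : ℝ} (hδ : 0 < δ) (hδa : δ ≤ a₁) (hBδ : B₃ * δ ≤ ε₀) (hε : ε₀ ≤ a₀)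
    {V : GaugeField (F.P K) k (SU N)} (hV : PlaqSmall δ V) {U₀ : GaugeField (F.P K) 0 (SU N)}
    (hU₀ : IsBackground (avOfRecord F N K) {U | U ∈ bgReg F N K k ε₀ ∧ Sect2.CoDivSmallOn Set.univ (ε₀ * (F.P K).eta k ^ 3) U} k V U₀) :
    PlaqSmall (B₃ * δ * (F.P K).eta k ^ 2) U₀ ∧ Sect2.CoDivSmallOn Set.univ (B₃ * δ * (F.P K).eta k ^ 3) U₀ := by
  -- the numerics carrier, the cube letter, the couplings
  obtain ⟨ν, hνM₁, hνr⟩ : ∃ ν : Stage7Numerics, ν.M₁ = max c 1 ∧ ν.r = 0 :=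
    ⟨{ M₁ := max c 1, M₂ := 0, r := 0, p₀ := 0, A₀ := 0, logσ₀ := 0, εreg := 0, ε₀ := 0 }, rfl, rfl⟩
  have hM₁pos : 0 < ν.M₁ := by rw [hνM₁]; exact lt_of_lt_of_le zero_lt_one (le_max_right _ _)
  have hL1 : 1 ≤ F.L := F.hL.2.le
  have hM : 1 ≤ F.L ^ c₁ := Nat.one_le_pow _ _ (by omega)
  -- the separated top index
  obtain ⟨s, htop, hsep⟩ := exists_seq_top (F := F) ν hM (fun _ => (0 : ℝ)) K k
  -- the guard
  have hadm : c ≤ ν.M₁ ∧ k + c₀ ≤ F.m + K ∧ F.L ^ c₁ ∣ F.L ^ c₁ ∧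
      ∀ i, 1 ≤ i → i ≤ k → dCubeSide (F.P K).L (F.L ^ c₁) (RkOfRecord (F.P K).L ν.r ((fun _ : ℕ => (0 : ℝ)) i)) i ∣ (F.P K).sitesPerDir 0 := by
    refine ⟨by rw [hνM₁]; exact le_max_left _ _, hc₀, dvd_rfl, fun i _ hi => ?_⟩
    rw [hνr, RkOfRecord_zero_r]
    exact dCubeSide_dvd_sitesPerDir K (by omega)
  have hε0 : 0 ≤ ε₀ := (mul_nonneg hB₃ hδ.le).trans hBδ
  have hsup : suppDomOfRecord F ν K s.Ω = Set.univ := suppDomOfRecord_top ν hM₁pos K hk htop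
  -- the text at the top index, thresholds `δ_n := δ`, datum `W := Ū U₀`
  have h := h15 ν (F.L ^ c₁) (fun _ => 0) K k s hsep hM₁pos hadm ε₀ (fun _ => δ)
    (fun n _ => ⟨hδ, hδa, hBδ⟩) (fun n _ => by linarith) (fun n _ => by linarith) hε
    (avgFamily (avOfRecord F N K) U₀) ?_ U₀ ?_
  · -- read the conclusion at scale `k`
    obtain ⟨h8, h9⟩ := h
    simp only [hsup] at h8 h9
    have hP : Sect2.omegaPlaqsTop s.Ω (Set.univ : Set (Site (F.P K) 0)) k = Set.univ := by
      rw [Sect2.omegaPlaqsTop_univ, omegaPlaqs, if_neg (by omega : k ≠ 0), htop k hk le_rfl, B8Eq17ClassAkV1.plaqsOf_univ]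
    have hB : Sect2.omegaBondsTop s.Ω (Set.univ : Set (Site (F.P K) 0)) k = Set.univ := by
      rw [Sect2.omegaBondsTop_univ, Sect2.omegaBonds, if_neg (by omega : k ≠ 0), htop k hk le_rfl, B8Eq17ClassAkV1.bondsOf_univ]
    refine ⟨fun p => h8 k le_rfl p (by rw [hP]; trivial), fun b hb => h9 k le_rfl b (by rw [hB]; exact hb)⟩
  · -- (7) at the top: `W_k = Ū^k U₀ = V` is `δ`-regular
    simp only [hsup]
    refine dataSmall7LamTopOf_top K hk htop ?_
    show PlaqSmall δ (Averaging.iter (avOfRecord F N K) k U₀)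
    rw [hU₀.1]; exact hV
  · -- `U₀` minimises over class (6)-top within print's fibre
    simp only [hsup]
    refine ⟨(mem_classTop_iff K htop hε0 U₀).2 hU₀.2.1, fun j b _ => rfl, fun U hU hUW => ?_⟩
    have hUcls := (mem_classTop_iff K htop hε0 U).1 hU
    have hiter : Averaging.iter (avOfRecord F N K) k U = V := by
      rw [← hU₀.1]
      funext b
      exact hUW k b (by show b ∈ lamBondsSeq s.Ω k k; rw [lamBondsSeq_top_self hk htop]; trivial)
    exact hU₀.2.2 U hUcls hiter

end Socket

/-! ## §7  `N = 2`, UNCONDITIONALLY inside the level guard: the S1c chain's [15] Prop. 8 top step (✓p767981) + 53′, read at the top index -/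

section SU2

/-- ★★★ **(8)→(9) FOR THE ONE-SCALE PROBLEM OF RECORD AT `N = 2`, NO HYPOTHESIS, INSIDE THE LEVEL GUARD.**  There are integers `c₀, c₁`, a constant `B₃ ≥ 2L²` and radii `ā, a₁ > 0`
(stub 1ᴮ's own: dag-n07-e ✓p767981 `K0Stub1BHolds.prop8StepCoPGridGBAt_holds`, pushed through k0-s1-w1's 53′ `variationalThm1RegSepCoP7MGB_of_prop8TopStepGB_lamDatum`) such that at
every torus `K` and every level `1 ≤ k` with `k + c₀ ≤ m + K`, `k + c₁ ≤ m + K`, for all `0 < δ ≤ a₁`, `B₃δ ≤ ε₀ ≤ ā`, every `δ`-regular level-`k` datum `V` and every minimiser `U₀` of the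
Wilson action over «`bgReg_k(ε₀)` ∩ (1.9) at `ε₀η_k³`» with `Ū^k U₀ = V`: `|U₀(∂p) − 1| < B₃δη_k²` and the (1.9) bound `B₃δη_k³`.  HONEST SCOPE: the content is the S1c chain's
([15] Prop. 8's top step at print's datum, a tree theorem for `N = 2`) read at the top index by §6; the witness's level guard is LARGE (`c₀ ≥ m + 48` in 125′), so this covers only levels far
below the top of the tower — it is NOT N07's Theorem-1 slot at the levels the K0∕N09 doors read, NOT existence, NOT uniqueness; N07 NOT discharged; nothing of Bałaban's asserted beyond the
landed chain. [cite: Balaban1985Variational, Thm 1 (8)–(10) p.279, Prop. 8 p.304, (7) p.278; Balaban1988Convergent, (2.1)–(2.2) pp.254–255, (2.12) p.256; Balaban1984PropagatorsII, (2.3) p.224; Balaban1987RG1, (0.21) p.256, (1.2) p.260] -/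
theorem exists_plaqSmall_of_isBackground_classTop_SU2 (F : T4Family) :
    ∃ (c₀ c₁ : ℕ) (B₃ ā a₁ : ℝ), 2 * (F.L : ℝ) ^ 2 ≤ B₃ ∧ 0 < ā ∧ 0 < a₁ ∧
      ∀ (K k : ℕ), 1 ≤ k → k + c₀ ≤ F.m + K → k + c₁ ≤ F.m + K →
        ∀ (ε₀ δ : ℝ), 0 < δ → δ ≤ a₁ → B₃ * δ ≤ ε₀ → ε₀ ≤ ā →
          ∀ (V : GaugeField (F.P K) k (SU 2)), PlaqSmall δ V → ∀ U₀ : GaugeField (F.P K) 0 (SU 2),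
            IsBackground (avOfRecord F 2 K) {U | U ∈ bgReg F 2 K k ε₀ ∧ Sect2.CoDivSmallOn Set.univ (ε₀ * (F.P K).eta k ^ 3) U} k V U₀ →
              PlaqSmall (B₃ * δ * (F.P K).eta k ^ 2) U₀ ∧ Sect2.CoDivSmallOn Set.univ (B₃ * δ * (F.P K).eta k ^ 3) U₀ := by
  obtain ⟨c, c₀, c₁, B₃, ā, a₁, hB₃, hā, ha₁, h8⟩ := prop8StepCoPGridGBAt_holds F
  have hL : (0 : ℝ) < (F.L : ℝ) := by exact_mod_cast lt_trans Nat.zero_lt_one F.hL.2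
  have hBpos : (0 : ℝ) < B₃ := lt_of_lt_of_le (mul_pos two_pos (pow_pos hL 2)) hB₃
  have h15 := variationalThm1RegSepCoP7MGB_of_prop8TopStepGB_lamDatum hBpos h8
  exact ⟨c₀, c₁, B₃, ā, a₁, hB₃, hā, ha₁, fun K k hk hc₀ hc₁ ε₀ δ hδ hδa hBδ hε V hV U₀ hU₀ =>
    plaqSmall_of_isBackground_classTop_of_thm1RegSepCoP7MGB F 2 hBpos.le h15 hk hc₀ hc₁ hδ hδa hBδ hε hV hU₀⟩

end SU2

/-! ## §8  The class IS [15] (2)'s space at `Ω_j = T`: `InUkClassB11` (node00-def-P11's (1.9) dictionary `coDivSmallOn_bondsOf_iff_regDivAt`) — the socket in n07-a∕n21-c currency -/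

section InUkClass

/-- **`bgReg_k(ε₀) ∩ {(1.9) at ε₀η_k³ on all bonds}` IS n01-b's `InUkClassB11 F N K k ε₀`** ([15] (2) at `Ω_j = T`, both clauses; `0 ≤ ε₀`) — by `inUkClassB11_iff` and
node00-def-P11's `Sect2.coDivSmallOn_bondsOf_iff_regDivAt` (`bondsOf T = all bonds`). [cite: Balaban1985Variational, (2) p.278; Balaban1985RegularSpaces, (1.9) p.77] -/
theorem inUkClassB11_iff_bgReg_and_coDivSmallOn (K k : ℕ) {ε₀ : ℝ} (hε : 0 ≤ ε₀) (U : GaugeField (F.P K) 0 (SU N)) :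
    InUkClassB11 F N K k ε₀ U ↔ U ∈ bgReg F N K k ε₀ ∧ Sect2.CoDivSmallOn Set.univ (ε₀ * (F.P K).eta k ^ 3) U := by
  have hη : 0 < (F.P K).eta k := pow_pos (inv_pos.mpr (Nat.cast_pos.mpr (F.P K).L_pos)) k
  rw [inUkClassB11_iff hε, ← B8Eq17ClassAkV1.bondsOf_univ, Sect2.coDivSmallOn_bondsOf_iff_regDivAt hη U k]

/-- The two classes as SETS. [cite: Balaban1985Variational, (2) p.278 (bookkeeping)] -/
theorem setOf_inUkClassB11_eq (K k : ℕ) {ε₀ : ℝ} (hε : 0 ≤ ε₀) :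
    {U : GaugeField (F.P K) 0 (SU N) | InUkClassB11 F N K k ε₀ U} = {U | U ∈ bgReg F N K k ε₀ ∧ Sect2.CoDivSmallOn Set.univ (ε₀ * (F.P K).eta k ^ 3) U} :=
  Set.ext fun U => inUkClassB11_iff_bgReg_and_coDivSmallOn K k hε U

variable (F N)

/-- ★★★ **THE SOCKET IN n07-a ∕ dag-n21-c CURRENCY**: the V23 text's (8)-antecedent ⟹ for every `(K, k)` inside the level guard, `0 < δ ≤ a₁`, `B₃δ ≤ ε₀ ≤ a₀`, every `δ`-regular datum `V`
and EVERY MINIMISER `U′` over [15] (2)'s space `𝔘_k(ε₀)` at `Ω_j = T` (`IsBackground (avOfRecord F N K) {U | InUkClassB11 F N K k ε₀ U} k V U′` — VERBATIM the hypothesis of dag-n21-c's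
`plaqSmall_minimiser_of_thm1_objects`): `PlaqSmall (B₃δη_k²) U′` AND `InUkClassB11 F N K k (B₃δ) U′` — the conclusion there obtained from n07-a's `hT1` ((8) existence + (6) uniqueness),
here from the K0 road's (8)-sentence alone.  CONDITIONAL on the text's antecedent; nothing of Bałaban's asserted. [cite: Balaban1985Variational, Thm 1 (6)–(10) pp.278–279, (2) p.278; Balaban1988Convergent, (2.12) p.256; Balaban1987RG1, (0.21) p.256] -/
theorem plaqSmall_of_isBackground_inUkClassB11_of_thm1RegSepCoP7MGB {c c₀ c₁ : ℕ} {B₃ a₀ a₁ : ℝ} (hB₃ : 0 ≤ B₃)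
    (h15 : VariationalThm1RegSepCoP7MGB F N
      (fun ν M g K k _s => c ≤ ν.M₁ ∧ k + c₀ ≤ F.m + K ∧ F.L ^ c₁ ∣ M ∧
        ∀ i, 1 ≤ i → i ≤ k → dCubeSide (F.P K).L M (RkOfRecord (F.P K).L ν.r (g i)) i ∣ (F.P K).sitesPerDir 0) (lamDatum F) (dataSmall7LamTopOf F N) B₃ a₀ a₁)
    {K k : ℕ} (hk : 1 ≤ k) (hc₀ : k + c₀ ≤ F.m + K) (hc₁ : k + c₁ ≤ F.m + K)
    {ε₀ δ : ℝ} (hδ : 0 < δ) (hδa : δ ≤ a₁) (hBδ : B₃ * δ ≤ ε₀) (hε : ε₀ ≤ a₀)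
    {V : GaugeField (F.P K) k (SU N)} (hV : PlaqSmall δ V) {U' : GaugeField (F.P K) 0 (SU N)}
    (hU' : IsBackground (avOfRecord F N K) {U | InUkClassB11 F N K k ε₀ U} k V U') :
    PlaqSmall (B₃ * δ * (F.P K).eta k ^ 2) U' ∧ InUkClassB11 F N K k (B₃ * δ) U' := by
  have hε0 : 0 ≤ ε₀ := (mul_nonneg hB₃ hδ.le).trans hBδ
  rw [setOf_inUkClassB11_eq K k hε0] at hU'
  obtain ⟨h8, h9⟩ := plaqSmall_of_isBackground_classTop_of_thm1RegSepCoP7MGB F N hB₃ h15 hk hc₀ hc₁ hδ hδa hBδ hε hV hU'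
  exact ⟨h8, (inUkClassB11_iff_bgReg_and_coDivSmallOn K k (mul_nonneg hB₃ hδ.le) U').2 ⟨(mem_bgReg_iff F N K k _ U').2 h8, h9⟩⟩

/-- ★★★ **`N = 2`, NO HYPOTHESIS, n21-c CURRENCY**: inside the witness's level guard every minimiser over `𝔘_k(ε₀)` at a `δ`-regular datum is `B₃δη_k²`-regular and lies in `𝔘_k(B₃δ)`.  Scope as
in §7 (deep levels only; not N07's slot at the doors' levels; N07 NOT discharged). [cite: Balaban1985Variational, Thm 1 (8)–(10) p.279, (2) p.278, Prop. 8 p.304; Balaban1988Convergent, (2.12) p.256] -/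
theorem exists_plaqSmall_of_isBackground_inUkClassB11_SU2 (F : T4Family) :
    ∃ (c₀ c₁ : ℕ) (B₃ ā a₁ : ℝ), 2 * (F.L : ℝ) ^ 2 ≤ B₃ ∧ 0 < ā ∧ 0 < a₁ ∧
      ∀ (K k : ℕ), 1 ≤ k → k + c₀ ≤ F.m + K → k + c₁ ≤ F.m + K →
        ∀ (ε₀ δ : ℝ), 0 < δ → δ ≤ a₁ → B₃ * δ ≤ ε₀ → ε₀ ≤ ā →
          ∀ (V : GaugeField (F.P K) k (SU 2)), PlaqSmall δ V → ∀ U' : GaugeField (F.P K) 0 (SU 2),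
            IsBackground (avOfRecord F 2 K) {U | InUkClassB11 F 2 K k ε₀ U} k V U' →
              PlaqSmall (B₃ * δ * (F.P K).eta k ^ 2) U' ∧ InUkClassB11 F 2 K k (B₃ * δ) U' := by
  obtain ⟨c, c₀, c₁, B₃, ā, a₁, hB₃, hā, ha₁, h8⟩ := prop8StepCoPGridGBAt_holds F
  have hL : (0 : ℝ) < (F.L : ℝ) := by exact_mod_cast lt_trans Nat.zero_lt_one F.hL.2
  have hBpos : (0 : ℝ) < B₃ := lt_of_lt_of_le (mul_pos two_pos (pow_pos hL 2)) hB₃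
  have h15 := variationalThm1RegSepCoP7MGB_of_prop8TopStepGB_lamDatum hBpos h8
  exact ⟨c₀, c₁, B₃, ā, a₁, hB₃, hā, ha₁, fun K k hk hc₀ hc₁ ε₀ δ hδ hδa hBδ hε V hV U' hU' =>
    plaqSmall_of_isBackground_inUkClassB11_of_thm1RegSepCoP7MGB F 2 hBpos.le h15 hk hc₀ hc₁ hδ hδa hBδ hε hV hU'⟩

end InUkClass

/-! ## §9  Consequence for NODE 00's ₈a rows: dag-n21-c's transfer for the minimiser OF RECORD needs no `hT1` inside the level guard (`N = 2`) -/

section UkOfRecord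

/-- ★★ **THE (8)→(9) TRANSFER FOR `U_k(ε₀; W) = Node00.Uk F 2 K k ε₀ W` FROM ₈a's ROWS ALONE, inside the level guard, `N = 2`** — dag-n21-c's `plaqSmall_Uk_of_thm1_objects` with its `hT1`
input REPLACED by §8's unconditional socket: if the level-`k` problem at a `δ`-regular `W` is solvable at radius `ε₀` and its minimiser of record lies in `𝔘_k(ε₀)` (₈a's rows G₈a-1 ∧ G₈a-3,
node00-def-B; displayed), then `|U_k(ε₀; W)(∂p) − 1| < B₃δη_k²` (`0 < δ ≤ a₁`, `B₃δ ≤ ε₀ ≤ ā`, `k + c₀, k + c₁ ≤ m + K`).  A minimiser over `bgReg(ε₀)` lying in the subclass `𝔘_k(ε₀)`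
minimises over the subclass.  Scope as in §7. [cite: Balaban1985Variational, Thm 1 (8)–(10) p.279, (2) p.278; Balaban1987RG1, (0.21) p.256, (1.1)–(1.2) p.260] -/
theorem exists_plaqSmall_Uk_of_ukRows_SU2 (F : T4Family) :
    ∃ (c₀ c₁ : ℕ) (B₃ ā a₁ : ℝ), 2 * (F.L : ℝ) ^ 2 ≤ B₃ ∧ 0 < ā ∧ 0 < a₁ ∧
      ∀ (K k : ℕ), 1 ≤ k → k + c₀ ≤ F.m + K → k + c₁ ≤ F.m + K →
        ∀ (ε₀ δ : ℝ), 0 < δ → δ ≤ a₁ → B₃ * δ ≤ ε₀ → ε₀ ≤ ā →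
          ∀ (W : GaugeField (F.P K) k (SU 2)), PlaqSmall δ W →
            UkExists F 2 K k ε₀ W → InUkClassB11 F 2 K k ε₀ (Uk F 2 K k ε₀ W) →
              PlaqSmall (B₃ * δ * (F.P K).eta k ^ 2) (Uk F 2 K k ε₀ W) := by
  obtain ⟨c₀, c₁, B₃, ā, a₁, hB₃, hā, ha₁, h⟩ := exists_plaqSmall_of_isBackground_inUkClassB11_SU2 F
  refine ⟨c₀, c₁, B₃, ā, a₁, hB₃, hā, ha₁, fun K k hk hc₀ hc₁ ε₀ δ hδ hδa hBδ hε W hW hex hmem => ?_⟩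
  have hbg := isBackground_Uk hex
  have hmin : IsBackground (avOfRecord F 2 K) {U | InUkClassB11 F 2 K k ε₀ U} k W (Uk F 2 K k ε₀ W) :=
    ⟨hbg.1, hmem, fun U hU hUW => hbg.2.2 U (InUkClassB11.mem_bgReg hU) hUW⟩
  exact (h K k hk hc₀ hc₁ ε₀ δ hδ hδa hBδ hε W hW _ hmin).1

end UkOfRecord

end Summit.QuantumFields.YangMills.BalabanUVNodes.K0TopSocketOfThm1RegText
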